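import Mathlib
import HarnessLib
import Summits.QuantumFields.YangMills.Theorems.MirrorModularBoostsHypercubicLimitPlaneLimitsDefs
import Literature.Analysis.FunctionSpaces.SchwartzFunctionalSubsequenceLimit
import Literature.MathematicalPhysics.AQFT.OSAxiomsSchwinger

/-!
# Line `Sketch` (coupling response), closure step Z2: plane-string limits from the uniform functional bound

Crux `stmt-QuantumFields-16154` (`HypercubicLimit`), line `Sketch`, reshape 4.  `stub_planeLimits`: a `k`-uniform E0′-type bound on
`⁰𝒮` for all renormalised plane-string distributions (`UniformFunctionalBoundPlanes`) gives ONE strictly increasing `φ` and limits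
`T n q` with `PlaneLimits r sch φ T` — convergence on `⁰𝒮` along `φ` for every arity and string, the bound inherited on ALL test
functions.  This is the tree's diagonal-subsequence + Hahn–Banach theorem
`SchwartzMap.exists_strictMono_forall_clm_tendsto_on_submodule` on the countable index set `Σ n, (Fin n → Plane)` with the
off-diagonal submodules.  No physics.
-/

noncomputable section

open scoped SchwartzMap
open MeasureTheory Filter Topology
open Literature.MathematicalPhysics.AQFT Literature.MathematicalPhysics.QuantumLattice
open Literature.MathematicalPhysics.QuantumFieldTheory

namespace Summit.QuantumFields.YangMills.Cruxes.HypercubicLimit.CouplingResponse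

/-- The off-diagonal test functions `⁰𝒮ₙ` as a `ℂ`-submodule of `𝓢((ℝ⁴)ⁿ, ℂ)`. [folklore] -/
theorem exists_offDiagonal_submodule (n : ℕ) :
    ∃ M : Submodule ℂ 𝓢((Fin n → EuclideanSpace ℝ (Fin 4)), ℂ),
      ∀ F, F ∈ M ↔ IsOffDiagonal F :=
  ⟨{ carrier := {F | IsOffDiagonal F}
     add_mem' := fun hF hG => hF.add hG
     zero_mem' := isOffDiagonal_zero
     smul_mem' := @fun c _ hG => hG.smul c }, fun _ => Iff.rfl⟩

/-- **Registered stub `stub_planeLimits` (Z2) of line `Sketch` — compactness.**  From the `k`-uniform functional bound on `⁰𝒮` for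
all plane strings, one subsequence `φ` and limits `T` with `PlaneLimits r sch φ T`. [folklore] -/
theorem stub_planeLimits :
    ∀ (G : Type) [Group G] [TopologicalSpace G] [IsTopologicalGroup G] [CompactSpace G] [MeasurableSpace G] [BorelSpace G] (r : LatticeRep G) (sch : SpeciesScheme (YMSpecies G)), UniformFunctionalBoundPlanes r sch → ∃ φ : ℕ → ℕ, StrictMono φ ∧ ∃ T : (n : ℕ) → (Fin n → Plane) → (𝓢((Fin n → EuclideanSpace ℝ (Fin 4)), ℂ) →L[ℂ] ℂ), PlaneLimits r sch φ T := by
  intro G _ _ _ _ _ _ r sch h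
  obtain ⟨s, α, β, hb⟩ := h
  -- the countable index set of (arity, plane string) and the off-diagonal submodules
  choose M hM using fun n : ℕ => exists_offDiagonal_submodule n
  set α' : ℝ := max α 0 with hα'
  have hαle : α ≤ α' := le_max_left _ _
  have hα0 : 0 ≤ α' := le_max_right _ _
  obtain ⟨φ, v, hφ, hv, hvb⟩ :=
    Literature.Analysis.FunctionSpaces.SchwartzMap.exists_strictMono_forall_clm_tendsto_on_submodule
      (ι := Σ n : ℕ, (Fin n → Plane)) (E := fun i => Fin i.1 → EuclideanSpace ℝ (Fin 4))
      (fun i => M i.1) (fun k i => planeDist r sch k i.1 i.2) (fun i => Finset.Iic (i.1 * s, i.1 * s))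
      (fun i => α' * (i.1.factorial : ℝ) ^ β) (fun i => by positivity)
      (fun i => Eventually.of_forall fun k θ hθ => by
        have hθ' : IsOffDiagonal θ := (hM i.1 θ).1 hθ
        have := hb i.1 i.2 θ hθ' k
        refine this.trans ?_
        show α * (i.1.factorial : ℝ) ^ β * schwartzNorm (i.1 * s) θ ≤
          α' * (i.1.factorial : ℝ) ^ β * schwartzNorm (i.1 * s) θ
        exact mul_le_mul_of_nonneg_right (mul_le_mul_of_nonneg_right hαle (by positivity))
          (schwartzNorm_nonneg _ _))
  refine ⟨φ, hφ, fun n q => v ⟨n, q⟩, fun n q F hF => hv ⟨n, q⟩ F ((hM n F).2 hF), s, α', β, fun n q F => ?_⟩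
  exact hvb ⟨n, q⟩ F

end Summit.QuantumFields.YangMills.Cruxes.HypercubicLimit.CouplingResponse

end
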